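import Mathlib
import Summits.Ventures.PercRepro2.TypedResidualCore
import Summits.Ventures.PercRepro2.TypedTwoDominates

/-!
# The core under (T23): only the type-`1` instances remain (blind cell PercRepro2, p2 g0,
2026-08-25; sub-claim S1, `proofs/subclaims/S1-REDUCTION.md`; the lead's ruling INBOX
2026-08-25T03:40:28Z (2))

Night-3's candidate row (T23) (`TypedTwoDominates.lean`: `N_{τ[e:=2]} ≥ N_{τ[e:=3]}` at every typed
edge of type `2` — a CONJECTURE of the cell, never a fact) contracts the type-`2` edges one at a
time. Interleaved with the nine rules of the S1 spine (the measure induction of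
`typedCount_nonneg_of_residualR` with one more case, applied AFTER the rules, so that (T23) is
needed only on the FULLY REDUCED instances — `T23Reduced`; night-3's TypedTwoDominatesRules
covers the reducible edges) it gives:

* **`typedCount_nonneg_of_coreT1 (hT23 : ∀ ends marks, T23Reduced …)`** — (TRI) on every instance from
  (TRI) on the TYPE-`1`-ONLY instances of `ResidualCore` (every typed edge open in exactly one
  copy: the three copies are edge-disjoint);
* **`HCov_all_of_residualCoreT1_all' (hT23 : T23Reduced_all R)`** and
  **`HCov_all_of_residualCoreT1_all (hT23 : T23_all R) : ResidualCoreT1_all R → HCov_all R`** —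
  CONDITIONAL on (T23): the crux of record from (TRI) on the type-`1`-only core.

Own code; standard axioms (the conditional theorems take `T23` as an explicit hypothesis).
-/

namespace Summit.Ventures.PercRepro2

open UnionCluster

namespace CovForm

namespace TypedRed

open Contract Untouched

section CoreT1

variable {V : Type*} {E : Type*} [DecidableEq V] [Fintype E] [DecidableEq E]
variable {R : Type*} [Field R] [LinearOrder R] [IsStrictOrderedRing R]

/-- **(T23) on the fully reduced instances only**: at a fully reduced typed graph with every edge
off `F` pinned closed, contracting a type-`2` edge does not raise the typed base. (The reducible
edges are covered by night-3's `TypedTwoDominatesRules`: there (T23) is a theorem given row 2′TRI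
one instance down.) -/
def T23Reduced (ends : E → Sym2 V) (o a₁ a₂ a₃ b : V) : Prop :=
  ∀ (F : Finset E) (z : Config E) (τ : E → ℕ), (∀ e ∈ F, τ e = 1 ∨ τ e = 2) →
    Reduced ends o a₁ a₂ a₃ b F → (∀ g, g ∉ F → z g = false) →
    ∀ e ∈ F, τ e = 2 →
      typedCount F z (Function.update τ e 3)
          (K3 ends o a₁ a₂ a₃ b : Config E → Config E → Config E → R) ≤
        typedCount F z τ (K3 ends o a₁ a₂ a₃ b)

omit [DecidableEq V] [IsStrictOrderedRing R] in
/-- (T23) everywhere gives (T23) on the fully reduced instances. -/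
theorem t23Reduced_of_t23 {ends : E → Sym2 V} {o a₁ a₂ a₃ b : V}
    (h : T23 ends o a₁ a₂ a₃ b (R := R)) : T23Reduced ends o a₁ a₂ a₃ b (R := R) :=
  fun F z τ hτ _ _ e heF he2 => h F z τ hτ e heF he2

/-- **THE SPINE UNDER (T23)**: with (T23) on the fully reduced instances of every graph and marking
over the given types, (TRI) on the type-`1`-only instances of `ResidualCore` gives (TRI) on every
instance. -/
theorem typedCount_nonneg_of_coreT1
    (hT23 : ∀ (ends : E → Sym2 V) (o a₁ a₂ a₃ b : V), T23Reduced ends o a₁ a₂ a₃ b (R := R))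
    (hNR : ∀ (ends : E → Sym2 V) (o a₁ a₂ a₃ b : V) (F : Finset E) (τ : E → ℕ),
      (∀ e ∈ F, τ e = 1) → ResidualCore ends o a₁ a₂ a₃ b F →
        0 ≤ typedCount F (fun _ => false) τ
          (K3 ends o a₁ a₂ a₃ b : Config E → Config E → Config E → R))
    (ends : E → Sym2 V) (o a₁ a₂ a₃ b : V) (F : Finset E) (z : Config E) (τ : E → ℕ)
    (hτ : ∀ e ∈ F, τ e = 1 ∨ τ e = 2) :
    0 ≤ typedCount F z τ (K3 ends o a₁ a₂ a₃ b : Config E → Config E → Config E → R) := by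
  generalize hn : redMeasure ends F z = n
  induction n using Nat.strong_induction_on generalizing ends o a₁ a₂ a₃ b F z τ with
  | _ n ih =>
  -- the base, then the rules in the order contraction, pinned loop, root pair, typed loop,
  -- unmarked leaf, pendant `b`, pendant `o`, parallel, series; last the residual case
  by_cases hB : Base5U4 ends o a₁ a₂ a₃ b F z τ
  · exact typedCount_nonneg_of_base5U4 ends o a₁ a₂ a₃ b F z τ hB hτ
  by_cases hc : ∃ g, g ∉ F ∧ z g = true ∧ ¬ (ends g).IsDiag
  · obtain ⟨g, hgF, hz, hnd⟩ := hc
    obtain ⟨⟨u, v⟩, huv⟩ := Quot.exists_rep (ends g)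
    have hg : ends g = s(u, v) := huv.symm
    have huv' : u ≠ v := by
      intro h
      apply hnd
      rw [hg, Sym2.mk_isDiag_iff]
      exact h
    rw [typedCount_contract_open ends o a₁ a₂ a₃ b hg F hgF z hz τ]
    exact ih _ (by rw [← hn]; exact redMeasure_contract_lt ends hg huv' hgF hz) _ _ _ _ _ _ F z τ
      hτ rfl
  by_cases hl : ∃ g, g ∉ F ∧ z g = true ∧ (ends g).IsDiag
  · obtain ⟨g, hgF, hz, hd⟩ := hl
    obtain ⟨⟨u, v⟩, huv⟩ := Quot.exists_rep (ends g)
    have hg : ends g = s(u, v) := huv.symm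
    have huv' : u = v := by
      rw [hg, Sym2.mk_isDiag_iff] at hd
      exact hd
    subst huv'
    rw [typedCount_pinned_loop ends o a₁ a₂ a₃ b hg F hgF z hz τ]
    exact ih _ (by rw [← hn]; exact redMeasure_update_closed_lt ends hgF hz) _ _ _ _ _ _ F _ τ
      hτ rfl
  by_cases hr : ∃ f ∈ F, ends f = s(a₁, a₂)
  · obtain ⟨f, hfF, hf⟩ := hr
    have h1 : 1 ≤ τ f := by rcases hτ f hfF with h | h <;> omega
    rw [typedCount_root_pair ends o a₁ a₂ a₃ b hf F hfF z τ h1]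
  by_cases htl : ∃ f ∈ F, (ends f).IsDiag
  · obtain ⟨f, hfF, hd⟩ := htl
    obtain ⟨⟨u, v⟩, huv⟩ := Quot.exists_rep (ends f)
    have hf : ends f = s(u, v) := huv.symm
    have huv' : u = v := by
      rw [hf, Sym2.mk_isDiag_iff] at hd
      exact hd
    subst huv'
    rw [typedCount_loop ends o a₁ a₂ a₃ b hf F hfF z τ,
      typedCount_type_zero F _ hfF z _ (Function.update_self _ _ _),
      typedCount_congr_τ (F.erase _) _ (τ' := τ)
        (fun e he => Function.update_of_ne (Finset.ne_of_mem_erase he) _ _)]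
    exact mul_nonneg (Nat.cast_nonneg _)
      (ih _ (by rw [← hn]; exact redMeasure_erase_update_lt ends hfF z false) _ _ _ _ _ _ _ _ τ
        (fun e he => hτ e (Finset.mem_of_mem_erase he)) rfl)
  by_cases hleaf : ∃ f ∈ F, ∃ l u : V, ends f = s(l, u) ∧ l ≠ u ∧ l ≠ o ∧ l ≠ a₁ ∧ l ≠ a₂ ∧
      l ≠ a₃ ∧ l ≠ b ∧ (∀ e', e' ≠ f → l ∈ ends e' → e' ∉ F ∧ z e' = false)
  · obtain ⟨f, hfF, l, u, hf, hlu, hlo, hl1, hl2, hl3, hlb, hcl⟩ := hleaf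
    rw [typedCount_unmarked_leaf' ends o a₁ a₂ a₃ b hf hlu hlo hl1 hl2 hl3 hlb F hfF z τ hcl,
      typedCount_type_zero F _ hfF z _ (Function.update_self _ _ _),
      typedCount_congr_τ (F.erase _) _ (τ' := τ)
        (fun e he => Function.update_of_ne (Finset.ne_of_mem_erase he) _ _)]
    exact mul_nonneg (Nat.cast_nonneg _)
      (ih _ (by rw [← hn]; exact redMeasure_erase_update_lt ends hfF z false) _ _ _ _ _ _ _ _ τ
        (fun e he => hτ e (Finset.mem_of_mem_erase he)) rfl)
  by_cases hpb : ∃ f ∈ F, ∃ u : V, ends f = s(b, u) ∧ b ≠ u ∧ b ≠ o ∧ b ≠ a₁ ∧ b ≠ a₂ ∧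
      b ≠ a₃ ∧ (∀ e', e' ≠ f → b ∈ ends e' → e' ∉ F ∧ z e' = false)
  · obtain ⟨f, hfF, u, hf, hbu, hbo, hb1, hb2, hb3, hcl⟩ := hpb
    have h1 : 1 ≤ τ f := by rcases hτ f hfF with h | h <;> omega
    rw [typedCount_pendant_b' ends o a₁ a₂ a₃ b hf hbu hbo hb1 hb2 hb3 F hfF z τ h1 hcl,
      typedCount_type_three F _ hfF z _ (Function.update_self _ _ _),
      typedCount_congr_τ (F.erase _) _ (τ' := τ)
        (fun e he => Function.update_of_ne (Finset.ne_of_mem_erase he) _ _)]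
    exact mul_nonneg (Nat.cast_nonneg _)
      (ih _ (by rw [← hn]; exact redMeasure_erase_update_lt ends hfF z true) _ _ _ _ _ _ _ _ τ
        (fun e he => hτ e (Finset.mem_of_mem_erase he)) rfl)
  by_cases hpo : ∃ f ∈ F, ∃ u : V, ends f = s(o, u) ∧ o ≠ u ∧ o ≠ a₁ ∧ o ≠ a₂ ∧ o ≠ a₃ ∧
      o ≠ b ∧ (∀ e', e' ≠ f → o ∈ ends e' → e' ∉ F ∧ z e' = false)
  · obtain ⟨f, hfF, u, hf, hou, ho1, ho2, ho3, hob, hcl⟩ := hpo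
    have h1 : 1 ≤ τ f := by rcases hτ f hfF with h | h <;> omega
    rw [typedCount_pendant_o' ends o a₁ a₂ a₃ b hf hou ho1 ho2 ho3 hob F hfF z τ h1 hcl,
      typedCount_type_three F _ hfF z _ (Function.update_self _ _ _),
      typedCount_congr_τ (F.erase _) _ (τ' := τ)
        (fun e he => Function.update_of_ne (Finset.ne_of_mem_erase he) _ _)]
    exact mul_nonneg (Nat.cast_nonneg _)
      (ih _ (by rw [← hn]; exact redMeasure_erase_update_lt ends hfF z true) _ _ _ _ _ _ _ _ τ
        (fun e he => hτ e (Finset.mem_of_mem_erase he)) rfl)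
  by_cases hpar : ∃ e ∈ F, ∃ f ∈ F, e ≠ f ∧ ends e = ends f
  · obtain ⟨e, heF, f, hfF, hef, hpar⟩ := hpar
    have heF' : e ∈ F.erase f := Finset.mem_erase.2 ⟨hef, heF⟩
    rw [typedCount_parallel ends o a₁ a₂ a₃ b hef hpar F heF hfF z τ (hτ e heF) (hτ f hfF),
      Finset.sum_range_succ, Finset.sum_range_succ, Finset.sum_range_succ, Finset.sum_range_succ,
      Finset.sum_range_zero, zero_add, muOr_zero _ _ (hτ e heF) (hτ f hfF), Nat.cast_zero, zero_mul,
      zero_add]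
    have hτ' : ∀ j, ∀ e' ∈ F.erase f, e' ≠ e →
        Function.update τ e j e' = 1 ∨ Function.update τ e j e' = 2 := by
      intro j e' he' hne
      rw [Function.update_of_ne hne]
      exact hτ e' (Finset.mem_of_mem_erase he')
    have hlt1 : redMeasure ends (F.erase f) (Function.update z f false) < n := by
      rw [← hn]; exact redMeasure_erase_update_lt ends hfF z false
    refine add_nonneg (add_nonneg (mul_nonneg (Nat.cast_nonneg _) ?_)
      (mul_nonneg (Nat.cast_nonneg _) ?_)) (mul_nonneg (Nat.cast_nonneg _) ?_)
    · refine ih _ hlt1 _ _ _ _ _ _ _ _ _ (fun e' he' => ?_) rfl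
      by_cases hne : e' = e
      · subst hne; rw [Function.update_self]; exact Or.inl rfl
      · exact hτ' 1 e' he' hne
    · refine ih _ hlt1 _ _ _ _ _ _ _ _ _ (fun e' he' => ?_) rfl
      by_cases hne : e' = e
      · subst hne; rw [Function.update_self]; exact Or.inr rfl
      · exact hτ' 2 e' he' hne
    · rw [typedCount_type_three (F.erase f) e heF' _ _ (Function.update_self _ _ _),
        typedCount_congr_τ ((F.erase f).erase e) _ (τ' := τ)
          (fun e' he' => Function.update_of_ne (Finset.ne_of_mem_erase he') _ _)]
      refine ih _ ?_ _ _ _ _ _ _ _ _ τ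
        (fun e' he' => hτ e' (Finset.mem_of_mem_erase (Finset.mem_of_mem_erase he'))) rfl
      exact (redMeasure_erase_update_lt ends heF' _ true).trans hlt1
  by_cases hser : ∃ e ∈ F, ∃ f ∈ F, e ≠ f ∧ ∃ u w v : V, ends e = s(u, w) ∧ ends f = s(w, v) ∧
      w ≠ u ∧ w ≠ v ∧ w ≠ o ∧ w ≠ a₁ ∧ w ≠ a₂ ∧ w ≠ a₃ ∧ w ≠ b ∧
      (∀ e', e' ≠ e → e' ≠ f → w ∈ ends e' → e' ∉ F ∧ z e' = false)
  · obtain ⟨e, heF, f, hfF, hef, u, w, v, he, hf, hwu, hwv, hwo, hw1, hw2, hw3, hwb, hcl⟩ := hser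
    have heF' : e ∈ F.erase f := Finset.mem_erase.2 ⟨hef, heF⟩
    rw [typedCount_series ends o a₁ a₂ a₃ b hef he hf hwu hwv hwo hw1 hw2 hw3 hwb F heF hfF z τ
        (hτ e heF) (hτ f hfF) hcl,
      Finset.sum_range_succ, Finset.sum_range_succ, Finset.sum_range_succ, Finset.sum_range_succ,
      Finset.sum_range_zero, zero_add, muAnd_three _ _ (hτ e heF) (hτ f hfF), Nat.cast_zero,
      zero_mul, add_zero]
    have hτ' : ∀ j, ∀ e' ∈ F.erase f, e' ≠ e →
        Function.update τ e j e' = 1 ∨ Function.update τ e j e' = 2 := by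
      intro j e' he' hne
      rw [Function.update_of_ne hne]
      exact hτ e' (Finset.mem_of_mem_erase he')
    have hlt1 : redMeasure ends (F.erase f) (Function.update z f true) < n := by
      rw [← hn]; exact redMeasure_erase_update_lt ends hfF z true
    refine add_nonneg (add_nonneg (mul_nonneg (Nat.cast_nonneg _) ?_)
      (mul_nonneg (Nat.cast_nonneg _) ?_)) (mul_nonneg (Nat.cast_nonneg _) ?_)
    · rw [typedCount_type_zero (F.erase f) e heF' _ _ (Function.update_self _ _ _),
        typedCount_congr_τ ((F.erase f).erase e) _ (τ' := τ)
          (fun e' he' => Function.update_of_ne (Finset.ne_of_mem_erase he') _ _)]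
      refine ih _ ?_ _ _ _ _ _ _ _ _ τ
        (fun e' he' => hτ e' (Finset.mem_of_mem_erase (Finset.mem_of_mem_erase he'))) rfl
      exact (redMeasure_erase_update_lt ends heF' _ false).trans hlt1
    · refine ih _ hlt1 _ _ _ _ _ _ _ _ _ (fun e' he' => ?_) rfl
      by_cases hne : e' = e
      · subst hne; rw [Function.update_self]; exact Or.inl rfl
      · exact hτ' 1 e' he' hne
    · refine ih _ hlt1 _ _ _ _ _ _ _ _ _ (fun e' he' => ?_) rfl
      by_cases hne : e' = e
      · subst hne; rw [Function.update_self]; exact Or.inr rfl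
      · exact hτ' 2 e' he' hne
  -- a typed edge reached by neither root in `z ∪ F` (rule (f))
  by_cases hfr : ∃ e ∈ F, ∀ p ∈ ends e, ¬ Conn ends (openF F z) a₁ p ∧ ¬ Conn ends (openF F z) a₂ p
  · obtain ⟨e, heF, hfree⟩ := hfr
    rw [typedCount_free_edge ends o a₁ a₂ a₃ b F heF z hfree τ,
      typedCount_type_zero F _ heF z _ (Function.update_self _ _ _),
      typedCount_congr_τ (F.erase _) _ (τ' := τ)
        (fun e' he' => Function.update_of_ne (Finset.ne_of_mem_erase he') _ _)]
    exact mul_nonneg (Nat.cast_nonneg _)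
      (ih _ (by rw [← hn]; exact redMeasure_erase_update_lt ends heF z false) _ _ _ _ _ _ _ _ τ
        (fun e' he' => hτ e' (Finset.mem_of_mem_erase he')) rfl)
  -- no rule applies and the instance is not in the base: it is residual (with the roots
  -- reaching every typed edge)
  have hz0 : ∀ g, g ∉ F → z g = false := by
    intro g hgF
    by_contra hz
    have hz' : z g = true := by
      cases h : z g
      · exact absurd h hz
      · rfl
    by_cases hd : (ends g).IsDiag
    · exact hl ⟨g, hgF, hz', hd⟩
    · exact hc ⟨g, hgF, hz', hd⟩
  have hRed : Reduced ends o a₁ a₂ a₃ b F :=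
    { no_root_pair := fun f hfF hf => hr ⟨f, hfF, hf⟩
      no_loop := fun f hfF hd => htl ⟨f, hfF, hd⟩
      no_parallel := fun e heF f hfF hef hp => hpar ⟨e, heF, f, hfF, hef, hp⟩
      no_leaf := fun f hfF l u hf hlu hlo hl1 hl2 hl3 hlb => by
        by_contra hno
        refine hleaf ⟨f, hfF, l, u, hf, hlu, hlo, hl1, hl2, hl3, hlb, fun e' hne hl' => ?_⟩
        have hnF : e' ∉ F := fun hF => hno ⟨e', hF, hne, hl'⟩
        exact ⟨hnF, hz0 e' hnF⟩
      no_pendant_b := fun f hfF u hf hbu hbo hb1 hb2 hb3 => by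
        by_contra hno
        refine hpb ⟨f, hfF, u, hf, hbu, hbo, hb1, hb2, hb3, fun e' hne hb' => ?_⟩
        have hnF : e' ∉ F := fun hF => hno ⟨e', hF, hne, hb'⟩
        exact ⟨hnF, hz0 e' hnF⟩
      no_pendant_o := fun f hfF u hf hou ho1 ho2 ho3 hob => by
        by_contra hno
        refine hpo ⟨f, hfF, u, hf, hou, ho1, ho2, ho3, hob, fun e' hne ho' => ?_⟩
        have hnF : e' ∉ F := fun hF => hno ⟨e', hF, hne, ho'⟩
        exact ⟨hnF, hz0 e' hnF⟩
      no_series := fun e heF f hfF hef u w v he hf hwu hwv hwo hw1 hw2 hw3 hwb => by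
        by_contra hno
        refine hser ⟨e, heF, f, hfF, hef, u, w, v, he, hf, hwu, hwv, hwo, hw1, hw2, hw3, hwb,
          fun e' hne hnf hw' => ?_⟩
        have hnF : e' ∉ F := fun hF => hno ⟨e', hF, hne, hnf, hw'⟩
        exact ⟨hnF, hz0 e' hnF⟩ }
  have hRes : Residual ends o a₁ a₂ a₃ b F := by
    have h5 : ¬ F.card ≤ 5 := fun h => hB (Or.inl h)
    have h1 : ¬ UntouchedBy ends F z a₁ := fun h => hB (Or.inr (Or.inl h))
    have h2 : ¬ UntouchedBy ends F z a₂ := fun h => hB (Or.inr (Or.inr (Or.inl h)))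
    have ho : ¬ UntouchedBy ends F z o := fun h => hB (Or.inr (Or.inr (Or.inr (Or.inl h))))
    have hb : ¬ UntouchedBy ends F z b := fun h => hB (Or.inr (Or.inr (Or.inr (Or.inr h))))
    have key : ∀ v : V, ¬ UntouchedBy ends F z v → ∃ e ∈ F, v ∈ ends e := by
      intro v hU
      by_contra hno
      exact hU fun e he ht => hno (exists_mem_ends_of_touches hz0 he ht)
    exact ⟨hRed, by omega, key a₁ h1, key a₂ h2, key o ho, key b hb⟩
  -- a typed edge of type `2` on the fully reduced instance: contract it, (T23) on reduced
  -- instances pays the difference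
  by_cases h2 : ∃ e ∈ F, τ e = 2
  · obtain ⟨e, heF, he2⟩ := h2
    refine le_trans ?_ (hT23 ends o a₁ a₂ a₃ b F z τ hτ hRed hz0 e heF he2)
    rw [typedCount_type_three F e heF z _ (Function.update_self _ _ _),
      typedCount_congr_τ (F.erase e) _ (τ' := τ)
        (fun e' he' => Function.update_of_ne (Finset.ne_of_mem_erase he') _ _)]
    exact ih _ (by rw [← hn]; exact redMeasure_erase_update_lt ends heF z true) _ _ _ _ _ _ _ _ τ
      (fun e' he' => hτ e' (Finset.mem_of_mem_erase he')) rfl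
  have hone : ∀ e ∈ F, τ e = 1 := fun e he => (hτ e he).resolve_right (fun h => h2 ⟨e, he, h⟩)
  have hResR : ResidualR ends o a₁ a₂ a₃ b F := by
    refine ⟨hRes, fun e heF => ?_⟩
    by_contra hno
    apply hfr
    refine ⟨e, heF, fun p hp => ?_⟩
    rw [openF_eq_typedConfig hz0]
    constructor
    · exact fun h => hno ⟨p, hp, Or.inl h⟩
    · exact fun h => hno ⟨p, hp, Or.inr h⟩
  rw [typedCount_congr_z F (z' := fun _ => false) (fun e he => hz0 e he) τ]
  -- the separated part (S2), the same-side root bridge (S2.b), the coincidences, or the core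
  by_cases hcon : Conn ends (typedConfig F) a₁ a₂
  · by_cases hbr : RootBridge.HasRootBridgeSameSide' ends o a₁ a₂ b F
    · exact RootBridge.typedCount_nonneg_of_hasRootBridgeSameSide' ends o a₁ a₂ a₃ b F τ hτ hbr
    by_cases hm : MarksDistinct o a₁ a₂ a₃ b
    · exact hNR ends o a₁ a₂ a₃ b F τ hone ⟨⟨⟨hResR.residual, hcon⟩, hResR.root_reach⟩, hbr, hm⟩
    · rw [typedCount_eq_zero_of_not_marksDistinct ends hm]
  · exact Separated.typedCount_nonneg_of_typedConfig_sep ends o a₁ a₂ a₃ b F τ hτ hcon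

end CoreT1

section Closure

variable (R : Type*) [Field R] [LinearOrder R] [IsStrictOrderedRing R]

/-- **(T23) for every finite graph and marking** (the candidate row as a named hypothesis). -/
def T23_all : Prop :=
  ∀ (V E : Type) [Fintype V] [DecidableEq V] [Fintype E] [DecidableEq E]
    (ends : E → Sym2 V) (o a₁ a₂ a₃ b : V), T23 ends o a₁ a₂ a₃ b (R := R)

/-- **(T23) on the fully reduced instances of every finite graph and marking** (the weaker
hypothesis the spine needs). -/
def T23Reduced_all : Prop :=
  ∀ (V E : Type) [Fintype V] [DecidableEq V] [Fintype E] [DecidableEq E]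
    (ends : E → Sym2 V) (o a₁ a₂ a₃ b : V), T23Reduced ends o a₁ a₂ a₃ b (R := R)

/-- **Row 2′TRI on the type-`1`-only instances of `ResidualCore`, over every finite graph.** -/
def ResidualCoreT1_all : Prop :=
  ∀ (V E : Type) [Fintype V] [DecidableEq V] [Fintype E] [DecidableEq E]
    (ends : E → Sym2 V) (o a₁ a₂ a₃ b : V) (F : Finset E) (τ : E → ℕ),
    (∀ e ∈ F, τ e = 1) → ResidualCore ends o a₁ a₂ a₃ b F →
      0 ≤ typedCount F (fun _ => false) τ
        (K3 ends o a₁ a₂ a₃ b : Config E → Config E → Config E → R)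

/-- **CONDITIONAL on (T23) at the fully reduced instances: the crux of record from (TRI) on the
type-`1`-only core.** -/
theorem HCov_all_of_residualCoreT1_all' (hT23 : T23Reduced_all R) (hc : ResidualCoreT1_all R) :
    HCov_all R := by
  intro V E _ _ _ _ ends p hp o a₁ a₂ a₃ b _ _ _ _ _ _ _ _ _ _
  refine HCov_of_typedBases ends o a₁ a₂ a₃ b (fun F z τ hτ => ?_) p hp
  exact typedCount_nonneg_of_coreT1 (fun ends o a₁ a₂ a₃ b => hT23 V E ends o a₁ a₂ a₃ b)
    (fun ends o a₁ a₂ a₃ b F τ h1 hcore => hc V E ends o a₁ a₂ a₃ b F τ h1 hcore)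
    ends o a₁ a₂ a₃ b F z τ hτ

/-- **CONDITIONAL on (T23): the crux of record from (TRI) on the type-`1`-only core.** -/
theorem HCov_all_of_residualCoreT1_all (hT23 : T23_all R) (hc : ResidualCoreT1_all R) :
    HCov_all R :=
  HCov_all_of_residualCoreT1_all' R
    (fun V E _ _ _ _ ends o a₁ a₂ a₃ b => t23Reduced_of_t23 (hT23 V E ends o a₁ a₂ a₃ b)) hc

end Closure

end TypedRed

end CovForm

end Summit.Ventures.PercRepro2
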